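import Mathlib
import HarnessLib
import Summits.Ventures.LatticeQCDFlow.Exactness.FlowPushforward
import Summits.Ventures.LatticeQCDFlow.Exactness.TorusCircleChart
import Summits.Ventures.LatticeQCDFlow.Exactness.SU2TorusAlcoveJacobian

/-!
# The affine chart `ζ` of the `SU(3)` cell: the right simplex is carried onto the Weyl alcove in eigen-phase coordinates with constant Jacobian `4π²/3`, so simplex flows become alcove flows with the SAME Jacobian

HONEST FRAMING: exact (Metropolis-corrected) sampling algorithms for lattice gauge theory;
figures of merit are autocorrelation/cost numbers at stated couplings and volumes; no
continuum-physics claim.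

Venture `LatticeQCDFlow` (cell pub-lqcd), topic `Exactness`; FANOUT row 10 (`eng-equiv`, engine
`latflow.equiv` `spectral.zeta` / `zeta_inv` / `simplex_vertices`, Boyda et al., PRD 103 (2021) 074504
eq. (21): `[y_k]_j = 2π(k/N − [k ≥ j])`; for `N = 3`, in the free eigen-phases `(x₁, x₂)` (`x₃ = −x₁ − x₂`),
`y₁ = (−4π/3, 2π/3)`, `y₂ = (−2π/3, −2π/3)`, `y₃ = (0, 0)` and `ζ(ρ) = y₁ + ρ₀ (y₂ − y₁) + ρ₁ (y₃ − y₁)`;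
"zeta is affine: its factors cancel" in the booked log-det).  NEW WORK of the cell over Mathlib's
`map_withDensity_abs_det_fderiv_eq_addHaar` and this row's `hasJacobian_of_presentation_ae`,
`HasJacobian.smul_measure`.  Nothing is cited as a fact; no number; no definition.  Step 3b for `N = 3`
(step 3a: `StickBreakingFinTwo.lean`; step 2b — that the image is one Weyl chamber of `Haar_{SΔ(3)}` in the
angle cube — is NOT here).

## What is typed (`ζ(ρ) = (−4π/3 + (2π/3)ρ₀ + (4π/3)ρ₁, 2π/3 − (4π/3)ρ₀ − (2π/3)ρ₁)` on `Fin 2 → ℝ`,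
`Δ° = {0 < ρ₀, 0 < ρ₁, ρ₀ + ρ₁ < 1}`)

* `hasFDerivAt_alcoveAffine_su3`, `det_alcoveAffineDeriv_su3` (`det dζ = 4π²/3`), `injective_alcoveAffine_su3`,
  `alcoveAffine_su3_vertices` (`ζ` maps `0, e₀, e₁` to `y₁, y₂, y₃`);
* **`map_alcoveAffine_su3`** — `ζ_* ((4π²/3) · Leb|_{Δ°}) = Leb|_{ζ(Δ°)}`;
* **`hasJacobian_alcove_of_simplexFlow_su3`** — a measurable `G` on the alcove intertwined a.e. with a
  simplex map `G'` having `HasJacobian (Leb|_{Δ°}) G' J'`, with `J ∘ ζ = J'` a.e., has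
  `HasJacobian (Leb|_{ζ(Δ°)}) G J`: the affine chart changes NO Jacobian (constant factors cancel).

NOT here: the identification of `ζ(Δ°)` with the chamber `{x₁ < x₂ < x₃ < x₁ + 2π}` and of
`(2π)⁻² Leb` on it with `Haar_{SΔ(3)}` restricted to one Weyl chamber (step 2b); `N ≥ 4`; any number.
-/

noncomputable section

namespace Summit.Ventures.LatticeQCDFlow.Exactness

open MeasureTheory Set Real
open scoped ENNReal

/-! ## The affine chart -/

/-- **Derivative of `ζ`**: the constant linear map with rows `(2π/3, 4π/3)` and `(−4π/3, −2π/3)`. -/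
theorem hasFDerivAt_alcoveAffine_su3 (ρ : Fin 2 → ℝ) :
    HasFDerivAt (fun r : Fin 2 → ℝ =>
        (![-(4 * π / 3) + 2 * π / 3 * r 0 + 4 * π / 3 * r 1, 2 * π / 3 - 4 * π / 3 * r 0 - 2 * π / 3 * r 1] :
          Fin 2 → ℝ))
      (ContinuousLinearMap.pi ![(2 * π / 3) • ContinuousLinearMap.proj (R := ℝ) (φ := fun _ : Fin 2 => ℝ) 0 +
          (4 * π / 3) • ContinuousLinearMap.proj (R := ℝ) (φ := fun _ : Fin 2 => ℝ) 1,
        -((4 * π / 3) • ContinuousLinearMap.proj (R := ℝ) (φ := fun _ : Fin 2 => ℝ) 0) -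
          (2 * π / 3) • ContinuousLinearMap.proj (R := ℝ) (φ := fun _ : Fin 2 => ℝ) 1]) ρ := by
  rw [hasFDerivAt_pi']
  intro i
  rw [ContinuousLinearMap.proj_pi]
  have h0 : HasFDerivAt (fun a : Fin 2 → ℝ => a 0)
      (ContinuousLinearMap.proj (R := ℝ) (φ := fun _ : Fin 2 => ℝ) 0) ρ := hasFDerivAt_apply 0 ρ
  have h1 : HasFDerivAt (fun a : Fin 2 → ℝ => a 1)
      (ContinuousLinearMap.proj (R := ℝ) (φ := fun _ : Fin 2 => ℝ) 1) ρ := hasFDerivAt_apply 1 ρ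
  fin_cases i
  · simp only [Fin.zero_eta, Matrix.cons_val_zero]
    exact ((h0.const_mul (2 * π / 3)).const_add (-(4 * π / 3))).add (h1.const_mul (4 * π / 3))
  · simp only [Fin.mk_one, Matrix.cons_val_one, Matrix.cons_val_zero]
    have h := ((h0.const_mul (4 * π / 3)).const_sub (2 * π / 3)).sub (h1.const_mul (2 * π / 3))
    exact h

/-- **`det dζ = 4π²/3`** (the area of the alcove `2π²/3` over the area of the right simplex `1/2`). -/
theorem det_alcoveAffineDeriv_su3 :
    (ContinuousLinearMap.pi ![(2 * π / 3) • ContinuousLinearMap.proj (R := ℝ) (φ := fun _ : Fin 2 => ℝ) 0 +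
          (4 * π / 3) • ContinuousLinearMap.proj (R := ℝ) (φ := fun _ : Fin 2 => ℝ) 1,
        -((4 * π / 3) • ContinuousLinearMap.proj (R := ℝ) (φ := fun _ : Fin 2 => ℝ) 0) -
          (2 * π / 3) • ContinuousLinearMap.proj (R := ℝ) (φ := fun _ : Fin 2 => ℝ) 1]).det = 4 * π ^ 2 / 3 := by
  rw [ContinuousLinearMap.det, ← LinearMap.det_toMatrix', Matrix.det_fin_two]
  simp [LinearMap.toMatrix'_apply]
  ring

/-- **`ζ` is injective.** -/
theorem injective_alcoveAffine_su3 :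
    Function.Injective (fun r : Fin 2 → ℝ =>
      (![-(4 * π / 3) + 2 * π / 3 * r 0 + 4 * π / 3 * r 1, 2 * π / 3 - 4 * π / 3 * r 0 - 2 * π / 3 * r 1] :
        Fin 2 → ℝ)) := by
  intro a b hab
  have hπ : 0 < π := pi_pos
  have h0 : -(4 * π / 3) + 2 * π / 3 * a 0 + 4 * π / 3 * a 1 = -(4 * π / 3) + 2 * π / 3 * b 0 + 4 * π / 3 * b 1 := by
    have := congr_fun hab 0
    simpa using this
  have h1 : 2 * π / 3 - 4 * π / 3 * a 0 - 2 * π / 3 * a 1 = 2 * π / 3 - 4 * π / 3 * b 0 - 2 * π / 3 * b 1 := by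
    have := congr_fun hab 1
    simpa using this
  have e0 : π * (a 0 - b 0) = 0 := by nlinarith [h0, h1]
  have e1 : π * (a 1 - b 1) = 0 := by nlinarith [h0, h1]
  have ha0 : a 0 = b 0 := by
    rcases mul_eq_zero.mp e0 with h | h
    · exact absurd h hπ.ne'
    · linarith
  have ha1 : a 1 = b 1 := by
    rcases mul_eq_zero.mp e1 with h | h
    · exact absurd h hπ.ne'
    · linarith
  funext i
  fin_cases i
  · exact ha0
  · exact ha1

/-- **The vertices**: `ζ(0) = y₁ = (−4π/3, 2π/3)`, `ζ(e₀) = y₂ = (−2π/3, −2π/3)`, `ζ(e₁) = y₃ = (0, 0)` —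
Boyda's `simplex_vertices(3)` read in the free eigen-phases. -/
theorem alcoveAffine_su3_vertices :
    (fun r : Fin 2 → ℝ =>
      (![-(4 * π / 3) + 2 * π / 3 * r 0 + 4 * π / 3 * r 1, 2 * π / 3 - 4 * π / 3 * r 0 - 2 * π / 3 * r 1] :
        Fin 2 → ℝ)) ![0, 0] = ![-(4 * π / 3), 2 * π / 3] ∧
    (fun r : Fin 2 → ℝ =>
      (![-(4 * π / 3) + 2 * π / 3 * r 0 + 4 * π / 3 * r 1, 2 * π / 3 - 4 * π / 3 * r 0 - 2 * π / 3 * r 1] :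
        Fin 2 → ℝ)) ![1, 0] = ![-(2 * π / 3), -(2 * π / 3)] ∧
    (fun r : Fin 2 → ℝ =>
      (![-(4 * π / 3) + 2 * π / 3 * r 0 + 4 * π / 3 * r 1, 2 * π / 3 - 4 * π / 3 * r 0 - 2 * π / 3 * r 1] :
        Fin 2 → ℝ)) ![0, 1] = ![0, 0] := by
  refine ⟨?_, ?_, ?_⟩ <;> (funext i; fin_cases i <;> simp <;> ring)

/-- **The affine chart presents Lebesgue measure on the alcove**: `ζ_* ((4π²/3) · Leb|_{Δ°}) = Leb|_{ζ(Δ°)}`. -/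
theorem map_alcoveAffine_su3 :
    Measure.map (fun r : Fin 2 → ℝ =>
        (![-(4 * π / 3) + 2 * π / 3 * r 0 + 4 * π / 3 * r 1, 2 * π / 3 - 4 * π / 3 * r 0 - 2 * π / 3 * r 1] :
          Fin 2 → ℝ))
      (ENNReal.ofReal (4 * π ^ 2 / 3) • volume.restrict {ρ : Fin 2 → ℝ | 0 < ρ 0 ∧ 0 < ρ 1 ∧ ρ 0 + ρ 1 < 1}) =
      volume.restrict ((fun r : Fin 2 → ℝ =>
        (![-(4 * π / 3) + 2 * π / 3 * r 0 + 4 * π / 3 * r 1, 2 * π / 3 - 4 * π / 3 * r 0 - 2 * π / 3 * r 1] :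
          Fin 2 → ℝ)) '' {ρ : Fin 2 → ℝ | 0 < ρ 0 ∧ 0 < ρ 1 ∧ ρ 0 + ρ 1 < 1}) := by
  have hS : MeasurableSet {ρ : Fin 2 → ℝ | 0 < ρ 0 ∧ 0 < ρ 1 ∧ ρ 0 + ρ 1 < 1} := by
    have h0 : Measurable fun ρ : Fin 2 → ℝ => ρ 0 := measurable_pi_apply 0
    have h1 : Measurable fun ρ : Fin 2 → ℝ => ρ 1 := measurable_pi_apply 1
    exact ((measurableSet_lt measurable_const h0).inter
      ((measurableSet_lt measurable_const h1).inter (measurableSet_lt (h0.add h1) measurable_const)))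
  have h := map_withDensity_abs_det_fderiv_eq_addHaar (volume : Measure (Fin 2 → ℝ)) hS.nullMeasurableSet
    (fun r _ => (hasFDerivAt_alcoveAffine_su3 r).hasFDerivWithinAt) injective_alcoveAffine_su3.injOn
  simp_rw [det_alcoveAffineDeriv_su3] at h
  rw [abs_of_pos (by positivity : (0 : ℝ) < 4 * π ^ 2 / 3), withDensity_const] at h
  exact h

/-- **Simplex flows become alcove flows with the same Jacobian.**  If `G'` has
`HasJacobian (Leb|_{Δ°}) G' J'`, and `G`, `J` on the alcove are measurable with `G (ζ ρ) = ζ (G' ρ)` and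
`J (ζ ρ) = J' ρ` for a.e. `ρ ∈ Δ°`, then `HasJacobian (Leb|_{ζ(Δ°)}) G J` — the affine chart contributes
no Jacobian factor ("zeta is affine: its factors cancel"). -/
theorem hasJacobian_alcove_of_simplexFlow_su3 {G' : (Fin 2 → ℝ) → (Fin 2 → ℝ)} {J' : (Fin 2 → ℝ) → ℝ≥0∞}
    (hG' : HasJacobian (volume.restrict {ρ : Fin 2 → ℝ | 0 < ρ 0 ∧ 0 < ρ 1 ∧ ρ 0 + ρ 1 < 1}) G' J')
    {G : (Fin 2 → ℝ) → (Fin 2 → ℝ)} (hG : Measurable G) {J : (Fin 2 → ℝ) → ℝ≥0∞} (hJ : Measurable J)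
    (hcomm : ∀ᵐ ρ ∂(volume.restrict {ρ : Fin 2 → ℝ | 0 < ρ 0 ∧ 0 < ρ 1 ∧ ρ 0 + ρ 1 < 1}),
      G (![-(4 * π / 3) + 2 * π / 3 * ρ 0 + 4 * π / 3 * ρ 1, 2 * π / 3 - 4 * π / 3 * ρ 0 - 2 * π / 3 * ρ 1]) =
        ![-(4 * π / 3) + 2 * π / 3 * (G' ρ) 0 + 4 * π / 3 * (G' ρ) 1,
          2 * π / 3 - 4 * π / 3 * (G' ρ) 0 - 2 * π / 3 * (G' ρ) 1])
    (hJ' : ∀ᵐ ρ ∂(volume.restrict {ρ : Fin 2 → ℝ | 0 < ρ 0 ∧ 0 < ρ 1 ∧ ρ 0 + ρ 1 < 1}),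
      J (![-(4 * π / 3) + 2 * π / 3 * ρ 0 + 4 * π / 3 * ρ 1, 2 * π / 3 - 4 * π / 3 * ρ 0 - 2 * π / 3 * ρ 1]) = J' ρ) :
    HasJacobian (volume.restrict ((fun r : Fin 2 → ℝ =>
        (![-(4 * π / 3) + 2 * π / 3 * r 0 + 4 * π / 3 * r 1, 2 * π / 3 - 4 * π / 3 * r 0 - 2 * π / 3 * r 1] :
          Fin 2 → ℝ)) '' {ρ : Fin 2 → ℝ | 0 < ρ 0 ∧ 0 < ρ 1 ∧ ρ 0 + ρ 1 < 1})) G J := by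
  have hζm : Measurable (fun r : Fin 2 → ℝ =>
      (![-(4 * π / 3) + 2 * π / 3 * r 0 + 4 * π / 3 * r 1, 2 * π / 3 - 4 * π / 3 * r 0 - 2 * π / 3 * r 1] :
        Fin 2 → ℝ)) :=
    (continuous_pi fun i => by
      fin_cases i
      · exact ((continuous_const.add (continuous_const.mul (continuous_apply 0))).add
          (continuous_const.mul (continuous_apply 1)))
      · exact ((continuous_const.sub (continuous_const.mul (continuous_apply 0))).sub
          (continuous_const.mul (continuous_apply 1)))).measurable
  refine hasJacobian_of_presentation_ae hζm map_alcoveAffine_su3 (hG'.smul_measure _) hG hJ ?_ ?_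
  · exact Measure.ae_smul_measure hcomm _
  · exact Measure.ae_smul_measure hJ' _

end Summit.Ventures.LatticeQCDFlow.Exactness
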